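import Summits.ABC.IUTFork.LDHTensorStepVI
import Summits.ABC.IUTFork.LDHTensorStepVM
import Summits.ABC.IUTFork.LDHTensorHoffM
import HarnessLib

/-!
# The fork at [IUTchIII] Corollary 3.12, L-DH level: the role of the (Ind3)-datum — [IUTchIV] Thm. 1.10 Step (vi)
# ("upper bound `0`" at the good odd unramified primes) holds for EVERY datum (the sharpness hypothesis is idle),
# and `−|log(Θ)|` is MONOTONE in the (Ind3)-region (the sharp datum gives the strongest form of (1.1))

Proof-only companion (abc-iut cell, seat abc-iut-w5-d244; D9′ rows O3/O4, node IUTchIV:Thm1.10 Step (vi); by-product of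
the audit of p413127 `LDHTensorHoffM` and of c312-d1's `LDHTensorStepVI`); TAKES NO SIDE. Mochizuki, *Inter-universal
Teichmüller theory IV* (RIMS ms Apr. 2020), proof of Thm. 1.10, Step (vi), kurims p. 29: "the “container of possible
images” is precisely equal to the tensor product of log-shells … Such an upper bound “`0`”"; Dupuy–Hilado,
arXiv:2004.13228 (pre-split text) §4.10, the (Ind3)-bound (4.10) "`(O_𝕃(−P_Θ))^{Ind3}` … given locally … by
`(q̲^{j²}_{v̲})^ℕ · Peel^j_{v̲} I^{⊗ j+1}_{V̲}`", §4.11–4.12 (`U_Θ`, the hull).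

WHAT THIS FILE PROVES (theorems only; no definitions, no named facts, no new hypothesis structure).
1. `DHData.bare3_subset_O_of_subset_bound` — for ANY Dupuy–Hilado datum, in the degrees `1 ≤ j ≤ ℓ⋇` and at a prime
   `p ∉ T₀ ⊇ char(S)`, the summand-level input `hbare` (`(O_𝕃(−P_Θ))^{Ind3}_{v⃗} ⊆ O_{v⃗}`) of abc-iut-S2's
   `logμ_hullUTheta_eq_zero_of_shell` FOLLOWS from the (Ind3)-bound (4.10) itself (`Ind3Datum.subset_bound`) once
   `I_{v⃗} = O_{v⃗}` (`hshell`) and unit scalars fix `O_{v⃗}` (`hpeel`): off `S` the theta scalar has `ord = 0`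
   (`DHData.thetaPilot_apply_of_not_mem`), so every `t^n · I_{v⃗} = O_{v⃗}`. The two landed Step (vi) files supply `hbare`
   from the DATUM instead (c312-d1 `hoff_ofTensor_of_sharp`: hypothesis `hsharp`; c312-3 `logμ_hullUTheta_ofIdelesM_eq_zero`:
   the MINIMAL datum) — that input is idle.
2. `logμ_hullUTheta_eq_zero_of_shell_peel`, `hoff_of_shell_peel`, `negLogThetaDHOn_eq_of_shell_peel`,
   `cor312DHLim_iff_of_shell_peel` — Step (vi), the `hoff` input of `localProofDataAvgOfDH`, the stabilisation of the
   finite prime sums and "(1.1) with `Σ_p` ⟺ its truncation", for ANY datum, from the three MODEL-level facts;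
   `logμ_hullUTheta_ofPrimesLine_eq_zero` — the same for the assembly `ofPrimesLine X P d T …` (any data `d`).
3. Instances over the REAL models for ARBITRARY (Ind3)-data: `hoff_ofTensor` (= c312-d1's theorem WITHOUT `hsharp`,
   Dupuy–Hilado normalisation) + `cor312DHLim_ofTensor_iff`; `hoff_ofPrimesLineM` + `cor312DHLim_ofPrimesLineM_iff`
   (Mochizuki normalisation; c312-3's `hoff_ofIdelesM` is the case of the minimal datum).
4. `UThetaUnion_mono_ind3`, `hullUTheta_mono_ind3`, `negLogThetaDH_mono_ind3`, `cor312DH_mono_ind3`,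
   `estimateDH_anti_ind3`, `cor312DH_ind3_of_sharp`, `cor312DH_ind3_of_ofIdelesM` — on FIXED ideles and packets,
   enlarging `(O_𝕃(−P_Θ))^{Ind3}` enlarges `U_Θ`, its hull and `−|log(Θ)| = ln ν̄_𝕃(hull(U_Θ))`: (1.1) `Cor312DH` for a
   datum IMPLIES (1.1) for every datum with a larger region; an estimate `EstimateDH δ` descends to smaller regions. So
   (1.1) for a SHARP datum (region `= O_𝕃(−P_Θ)`; the idele-built main-line datum `ofIdelesM`, planner ruling R6-b)
   implies (1.1) for EVERY admissible (Ind3)-datum on the same ideles — the main line is the STRONGEST of the DH readings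
   of (Ind3) kept by R6-a. Inequalities between HYPOTHESES; nothing asserted.
UPSHOT (neutral): off `V^dst` the contribution of `hull(U_Θ)` to `−|log(Θ)|` is `0` for every admissible (Ind3)-region in
both recorded shell normalisations — print's "precisely equal to the tensor product of log-shells"; the (Ind3) choice
acts only on `V^dst`, and monotonically. [cite: Mochizuki2012, IUTchIV Thm 1.10 proof Step (vi) p.29]
[cite: DupuyHilado2025, §4.10–4.12] [claim: Mochizuki2012, status: disputed]
HONEST SCOPE: every hypothesis is named (odd prime, unramified fields, `dst`/`T₀ ⊇ char(S)`); `Cor312DH`, `Cor312DHOn`,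
`Cor312DHLim`, `EstimateDH` remain HYPOTHESES on both sides of every `↔`/`→`; nothing here asserts them or takes a side
on Cor. 3.12; typed ≠ discharged elsewhere.
-/

noncomputable section

open Set Finset

namespace Summit.ABC.IUTFork

open Literature.IUT.LogVolume NumberField IsDedekindDomain
open scoped Pointwise

variable {F : Type} [Field F] [NumberField F]

namespace DHData

/-! ## 1. `hbare` from the (Ind3)-bound (4.10), for any datum -/

section AnyDatum

variable (D : DHData F)

/-- A place over a prime `p ∉ T₀ ⊇ char(S)` is not in `S`. [folklore] -/
theorem not_mem_S_of_prime_not_mem {T₀ : Finset ℕ} (hST : ∀ v ∈ D.X.S, residueChar F v ∈ T₀)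
    {p : ℕ} (hp : p.Prime) (hpT : p ∉ T₀) (v : placesOver F p) : v.1 ∉ D.X.S := by
  intro hv
  haveI : Fact p.Prime := ⟨hp⟩
  have h := hST v.1 hv
  rw [(mem_placesOver_iff_residueChar v.1).mp v.2] at h
  exact hpT h

/-- Iterating a map that fixes a set fixes the set. [folklore] -/
private theorem image_iterate_eq_of_image_eq {α : Type*} {f : α → α} {s : Set α} (h : f '' s = s) (n : ℕ) :
    f^[n] '' s = s := by
  induction n with
  | zero => simp
  | succ n ih => rw [Function.iterate_succ, Set.image_comp, h, ih]

/-- **`hbare` for ANY Dupuy–Hilado datum**: in a degree `1 ≤ j ≤ ℓ⋇`, at a prime `p ∉ T₀ ⊇ char(S)` where the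
log-shell is the integral structure (`hshell`) and unit scalars fix `O_{v⃗}` under the peel action (`hpeel`), the
(Ind3)-region is integral: `(O_𝕃(−P_Θ))^{Ind3}_{v⃗} ⊆ O_{v⃗}` — from the (Ind3)-bound (4.10) `⊆ ⋃_n t^n·I_{v⃗}` with
`t = t_{Θ,j,v_j}` a unit off `S`. [cite: DupuyHilado2025, §4.10] -/
theorem bare3_subset_O_of_subset_bound {T₀ : Finset ℕ} (hST : ∀ v ∈ D.X.S, residueChar F v ∈ T₀)
    {p : ℕ} (hp : p.Prime) (hpT : p ∉ T₀) {j : ℕ} (hj : 1 ≤ j) (hjl : j ≤ D.X.lstar)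
    (hshell : ∀ e : Fin (j + 1) → placesOver F p, D.M.shell p j e = D.M.O p j e)
    (hpeel : ∀ (e : Fin (j + 1) → placesOver F p) (t : D.M.Λ p (e (Fin.last j))), D.M.ordv t = 0 →
      D.M.peel t '' D.M.O p j e = D.M.O p j e)
    (e : Fin (j + 1) → placesOver F p) : D.ind3.bare3 p j e ⊆ D.M.O p j e := by
  obtain ⟨i, rfl⟩ : ∃ i, j = i + 1 := ⟨j - 1, by omega⟩
  have hi : i < D.X.lstar := by omega
  -- the theta scalar at the last place is a unit off `S`
  have h0 : D.M.ordv (D.tΘ ⟨i, hi⟩ p (e (Fin.last (i + 1)))) = 0 := by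
    rw [D.tΘ_ord]
    exact D.thetaPilot_apply_of_not_mem (D.not_mem_S_of_prime_not_mem hST hp hpT _) _
  refine (D.ind3.subset_bound p ⟨i, hi⟩ e).trans ?_
  refine Set.iUnion_subset fun n => ?_
  rw [hshell e, image_iterate_eq_of_image_eq (hpeel e _ h0) n]

/-- **Step (vi) at one summand, for ANY datum**: in a degree `1 ≤ j ≤ ℓ⋇`, at `p ∉ T₀ ⊇ char(S)` where the log-shell is
the hull-closed integral structure fixed by unit scalars, `log μ̄(hull(U_Θ)_{v⃗}) = 0` — NO condition on the
(Ind3)-datum. [cite: Mochizuki2012, IUTchIV Thm 1.10 proof Step (vi) p.29] -/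
theorem logμ_hullUTheta_eq_zero_of_shell_peel {T₀ : Finset ℕ} (hST : ∀ v ∈ D.X.S, residueChar F v ∈ T₀)
    {p : ℕ} (hp : p.Prime) (hpT : p ∉ T₀) {j : ℕ} (hj : 1 ≤ j) (hjl : j ≤ D.X.lstar)
    (hshell : ∀ e : Fin (j + 1) → placesOver F p, D.M.shell p j e = D.M.O p j e)
    (hhull : ∀ e : Fin (j + 1) → placesOver F p, D.M.hullLoc p j e (D.M.O p j e) = D.M.O p j e)
    (hpeel : ∀ (e : Fin (j + 1) → placesOver F p) (t : D.M.Λ p (e (Fin.last j))), D.M.ordv t = 0 →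
      D.M.peel t '' D.M.O p j e = D.M.O p j e)
    (e : Fin (j + 1) → placesOver F p) : D.M.logμ (D.M.hullUTheta D.ind3 p j e) = 0 :=
  D.logμ_hullUTheta_eq_zero_of_shell hST hp hpT hshell hhull
    (D.bare3_subset_O_of_subset_bound hST hp hpT hj hjl hshell hpeel) e

/-- **The Step (vi) input `hoff` for ANY datum** (shape of `localProofDataAvgOfDH`): off `dst ⊇ char(S)`, where the three
model-level facts hold in the degrees `1 ≤ j ≤ ℓ⋇`, `log μ̄ ≤ 0`. [cite: Mochizuki2012, IUTchIV Thm 1.10 proof Step (vi) p.29] -/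
theorem hoff_of_shell_peel (dst : Finset ℕ) (hST : ∀ v ∈ D.X.S, residueChar F v ∈ dst)
    (hshell : ∀ p, p.Prime → p ∉ dst → ∀ j, 1 ≤ j → j ≤ D.X.lstar → ∀ e : Fin (j + 1) → placesOver F p,
      D.M.shell p j e = D.M.O p j e)
    (hhull : ∀ p, p.Prime → p ∉ dst → ∀ j, 1 ≤ j → j ≤ D.X.lstar → ∀ e : Fin (j + 1) → placesOver F p,
      D.M.hullLoc p j e (D.M.O p j e) = D.M.O p j e)
    (hpeel : ∀ p, p.Prime → p ∉ dst → ∀ j, 1 ≤ j → j ≤ D.X.lstar → ∀ (e : Fin (j + 1) → placesOver F p)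
      (t : D.M.Λ p (e (Fin.last j))), D.M.ordv t = 0 → D.M.peel t '' D.M.O p j e = D.M.O p j e) :
    ∀ p ∈ D.T, p ∉ dst → ∀ j, 1 ≤ j → j ≤ D.X.lstar → ∀ e : Fin (j + 1) → placesOver F p,
      D.M.logμ (D.M.hullUTheta D.ind3 p j e) ≤ 0 :=
  fun p hp hpd j hj hjl e => (D.logμ_hullUTheta_eq_zero_of_shell_peel hST (D.T_prime p hp) hpd hj hjl
    (hshell p (D.T_prime p hp) hpd j hj hjl) (hhull p (D.T_prime p hp) hpd j hj hjl)
    (hpeel p (D.T_prime p hp) hpd j hj hjl) e).le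

/-- **Stabilisation for ANY datum** from the three model-level facts off `T₀ ⊇ char(S)`: `ln ν̄_{𝕃,T'}(hull(U_Θ)) =
ln ν̄_{𝕃,T₀}(hull(U_Θ))` for every finite set of primes `T' ⊇ T₀`. [cite: DupuyHilado2025, §1 p. 4, Def. 3.6.3] -/
theorem negLogThetaDHOn_eq_of_shell_peel {T₀ T' : Finset ℕ} (hST : ∀ v ∈ D.X.S, residueChar F v ∈ T₀)
    (hshell : ∀ p, p.Prime → p ∉ T₀ → ∀ j, 1 ≤ j → j ≤ D.X.lstar → ∀ e : Fin (j + 1) → placesOver F p,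
      D.M.shell p j e = D.M.O p j e)
    (hhull : ∀ p, p.Prime → p ∉ T₀ → ∀ j, 1 ≤ j → j ≤ D.X.lstar → ∀ e : Fin (j + 1) → placesOver F p,
      D.M.hullLoc p j e (D.M.O p j e) = D.M.O p j e)
    (hpeel : ∀ p, p.Prime → p ∉ T₀ → ∀ j, 1 ≤ j → j ≤ D.X.lstar → ∀ (e : Fin (j + 1) → placesOver F p)
      (t : D.M.Λ p (e (Fin.last j))), D.M.ordv t = 0 → D.M.peel t '' D.M.O p j e = D.M.O p j e)
    (h : T₀ ⊆ T') (hT' : ∀ p ∈ T', p.Prime) : D.negLogThetaDHOn T' = D.negLogThetaDHOn T₀ :=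
  D.negLogThetaDHOn_eq_of_degrees
    (fun p hp hpT j hj hjl e => D.logμ_hullUTheta_eq_zero_of_shell_peel hST hp hpT hj hjl
      (hshell p hp hpT j hj hjl) (hhull p hp hpT j hj hjl) (hpeel p hp hpT j hj hjl) e)
    h hT'

/-- **(1.1) with `Σ_p` ⟺ the truncation to `T₀`** (`T ⊆ T₀`, primes) for ANY datum, from the three model-level
facts off `T₀`. HYPOTHESES on both sides; nothing asserted. [claim: Mochizuki2012, status: disputed] -/
theorem cor312DHLim_iff_of_shell_peel {T₀ : Finset ℕ} (hT : D.T ⊆ T₀) (hT₀ : ∀ p ∈ T₀, p.Prime)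
    (hshell : ∀ p, p.Prime → p ∉ T₀ → ∀ j, 1 ≤ j → j ≤ D.X.lstar → ∀ e : Fin (j + 1) → placesOver F p,
      D.M.shell p j e = D.M.O p j e)
    (hhull : ∀ p, p.Prime → p ∉ T₀ → ∀ j, 1 ≤ j → j ≤ D.X.lstar → ∀ e : Fin (j + 1) → placesOver F p,
      D.M.hullLoc p j e (D.M.O p j e) = D.M.O p j e)
    (hpeel : ∀ p, p.Prime → p ∉ T₀ → ∀ j, 1 ≤ j → j ≤ D.X.lstar → ∀ (e : Fin (j + 1) → placesOver F p)
      (t : D.M.Λ p (e (Fin.last j))), D.M.ordv t = 0 → D.M.peel t '' D.M.O p j e = D.M.O p j e) :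
    D.Cor312DHLim ↔ D.Cor312DHOn T₀ :=
  D.cor312DHLim_iff_of_degrees
    (fun p hp hpT j hj hjl e => D.logμ_hullUTheta_eq_zero_of_shell_peel (fun v hv => hT (D.S_sub v hv)) hp hpT
      hj hjl (hshell p hp hpT j hj hjl) (hhull p hp hpT j hj hjl) (hpeel p hp hpT j hj hjl) e)
    hT hT₀

end AnyDatum

/-! ## 2. The assembly `ofPrimesLine`: the three facts about the GIVEN packet suffice, for any data -/

/-- **Step (vi) for `DHData.ofPrimesLine X P d T …` with ANY per-prime data `d`**, from the three facts about the GIVEN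
packet `P p hp` in the degree `1 ≤ j ≤ ℓ⋇` at `p ∉ dst ⊇ char(S)`. [cite: Mochizuki2012, IUTchIV Thm 1.10 proof Step (vi) p.29] -/
theorem logμ_hullUTheta_ofPrimesLine_eq_zero (X : PilotData F) (P : ∀ p : ℕ, p.Prime → PrimePacket F p)
    (d : ∀ (p : ℕ) (hp : p.Prime), (P p hp).DHDatum X)
    (T : Finset ℕ) (T_prime : ∀ p ∈ T, p.Prime) (S_sub : ∀ v ∈ X.S, residueChar F v ∈ T)
    (dst : Finset ℕ) (hST : ∀ v ∈ X.S, residueChar F v ∈ dst)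
    {p : ℕ} (hp : p.Prime) (hpd : p ∉ dst) {j : ℕ} (hj : 1 ≤ j) (hjl : j ≤ X.lstar)
    (hshell : ∀ e : Fin (j + 1) → placesOver F p, (P p hp).shell j e = (P p hp).O j e)
    (hhull : ∀ e : Fin (j + 1) → placesOver F p, (P p hp).hullLoc j e ((P p hp).O j e) = (P p hp).O j e)
    (hpeel : ∀ (e : Fin (j + 1) → placesOver F p) (t : (P p hp).Λ (e (Fin.last j))), (P p hp).ordv t = 0 →
      (P p hp).peel t '' (P p hp).O j e = (P p hp).O j e)
    (e : Fin (j + 1) → placesOver F p) :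
    (ofPrimesLine X P d T T_prime S_sub).M.logμ
      ((ofPrimesLine X P d T T_prime S_sub).M.hullUTheta (ofPrimesLine X P d T T_prime S_sub).ind3 p j e) = 0 := by
  -- move the three facts from the given packet onto the `p`-part of the assembled datum
  have key := ofPrimesLine_prime_elim X P d T T_prime S_sub hp
    (fun Q _ _ => (∀ e' : Fin (j + 1) → placesOver F p, Q.shell j e' = Q.O j e') ∧
      (∀ e' : Fin (j + 1) → placesOver F p, Q.hullLoc j e' (Q.O j e') = Q.O j e') ∧
      (∀ (e' : Fin (j + 1) → placesOver F p) (t : Q.Λ (e' (Fin.last j))), Q.ordv t = 0 →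
        Q.peel t '' Q.O j e' = Q.O j e'))
    ⟨hshell, hhull, hpeel⟩
  obtain ⟨hshell', hhull', hpeel'⟩ := key
  exact (ofPrimesLine X P d T T_prime S_sub).logμ_hullUTheta_eq_zero_of_shell_peel hST hp hpd hj hjl
    (fun e' => hshell' e') (fun e' => hhull' e') (fun e' t ht => hpeel' e' t ht) e

/-! ## 3. The REAL models, arbitrary (Ind3)-data -/

section Real

variable (X : PilotData F) (𝔽 : LocalFieldFamily F)
  (T : Finset ℕ) (T_prime : ∀ p ∈ T, p.Prime) (S_sub : ∀ v ∈ X.S, residueChar F v ∈ T)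

/-- **Step (vi) over the real model in Dupuy–Hilado's normalisation, ANY (Ind3)-data `d`**: at a prime `p > 2` outside
`dst ⊇ char(S)` with every `K_{v̲}` (`v ∣ p`) unramified, `log μ̄(hull(U_Θ)_{v⃗}) = 0` in the degrees `1 ≤ j ≤ ℓ⋇`.
[cite: Mochizuki2012, IUTchIV Thm 1.10 proof Step (vi) p.29] -/
theorem logμ_hullUTheta_ofTensor_eq_zero
    (d : ∀ (p : ℕ) (hp : p.Prime), (@realPrimePacket F _ _ p ⟨hp⟩ (𝔽 p hp)).DHDatum X)
    (dst : Finset ℕ) (hST : ∀ v ∈ X.S, residueChar F v ∈ dst)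
    {p : ℕ} [hp : Fact p.Prime] (hpd : p ∉ dst) (hodd : 2 < p)
    (hunram : ∀ v : placesOver F p, absRamificationIdx p ((𝔽 p hp.out).k v) = 1)
    {j : ℕ} (hj : 1 ≤ j) (hjl : j ≤ X.lstar) (e : Fin (j + 1) → placesOver F p) :
    (ofTensor X 𝔽 d T T_prime S_sub).M.logμ
      ((ofTensor X 𝔽 d T T_prime S_sub).M.hullUTheta (ofTensor X 𝔽 d T T_prime S_sub).ind3 p j e) = 0 :=
  logμ_hullUTheta_ofPrimesLine_eq_zero X (fun q hq => @realPrimePacket F _ _ q ⟨hq⟩ (𝔽 q hq)) d T T_prime S_sub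
    dst hST hp.out hpd hj hjl
    (fun e' => realPrimePacket_shell_eq_O (𝔽 p hp.out) hodd hj e' (fun a => hunram (e' a)))
    (fun e' => realPrimePacket_hullLoc_O (𝔽 p hp.out) e')
    (fun e' t ht => realPrimePacket_peel_O_of_ordv_eq_zero (𝔽 p hp.out) e' t ht) e

/-- **`hoff` over the real model in Dupuy–Hilado's normalisation WITHOUT the sharpness hypothesis**: c312-d1's
`hoff_ofTensor_of_sharp` with `hsharp` removed (it is implied, in the degrees used, by the (Ind3)-bound (4.10)).
[cite: Mochizuki2012, IUTchIV Thm 1.10 proof Step (vi) p.29] [claim: Mochizuki2012, status: disputed] -/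
theorem hoff_ofTensor
    (d : ∀ (p : ℕ) (hp : p.Prime), (@realPrimePacket F _ _ p ⟨hp⟩ (𝔽 p hp)).DHDatum X)
    (dst : Finset ℕ) (hST : ∀ v ∈ X.S, residueChar F v ∈ dst)
    (hodd : ∀ p ∈ T, p ∉ dst → 2 < p)
    (hunram : ∀ (p : ℕ) [hp : Fact p.Prime], p ∈ T → p ∉ dst → ∀ v : placesOver F p,
      absRamificationIdx p ((𝔽 p hp.out).k v) = 1) :
    ∀ p ∈ (ofTensor X 𝔽 d T T_prime S_sub).T, p ∉ dst → ∀ j, 1 ≤ j →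
      j ≤ (ofTensor X 𝔽 d T T_prime S_sub).X.lstar → ∀ e : Fin (j + 1) → placesOver F p,
        (ofTensor X 𝔽 d T T_prime S_sub).M.logμ
          ((ofTensor X 𝔽 d T T_prime S_sub).M.hullUTheta (ofTensor X 𝔽 d T T_prime S_sub).ind3 p j e) ≤ 0 := by
  intro p hpT hpd j hj hjl e
  haveI : Fact p.Prime := ⟨T_prime p hpT⟩
  exact (logμ_hullUTheta_ofTensor_eq_zero X 𝔽 T T_prime S_sub d dst hST hpd (hodd p hpT hpd) (hunram p hpT hpd)
    hj hjl e).le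

/-- **Stabilisation, Dupuy–Hilado normalisation, ANY data**: off a finite `T₀ ⊇ T` outside which every prime is odd
with unramified fields, (1.1) with `Σ_p` ⟺ its truncation to `T₀`. HYPOTHESES on both sides. [claim: Mochizuki2012, status: disputed] -/
theorem cor312DHLim_ofTensor_iff
    (d : ∀ (p : ℕ) (hp : p.Prime), (@realPrimePacket F _ _ p ⟨hp⟩ (𝔽 p hp)).DHDatum X)
    (T₀ : Finset ℕ) (hT : T ⊆ T₀) (hT₀ : ∀ p ∈ T₀, p.Prime)
    (hodd : ∀ p : ℕ, p.Prime → p ∉ T₀ → 2 < p)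
    (hunram : ∀ (p : ℕ) [hp : Fact p.Prime], p ∉ T₀ → ∀ v : placesOver F p,
      absRamificationIdx p ((𝔽 p hp.out).k v) = 1) :
    (ofTensor X 𝔽 d T T_prime S_sub).Cor312DHLim ↔ (ofTensor X 𝔽 d T T_prime S_sub).Cor312DHOn T₀ :=
  (ofTensor X 𝔽 d T T_prime S_sub).cor312DHLim_iff_of_degrees
    (fun p hp hpT j hj hjl e => by
      haveI : Fact p.Prime := ⟨hp⟩
      exact logμ_hullUTheta_ofTensor_eq_zero X 𝔽 T T_prime S_sub d T₀ (fun v hv => hT (S_sub v hv)) hpT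
        (hodd p hp hpT) (hunram p hpT) hj hjl e)
    hT hT₀

/-- **Step (vi) over the real model in Mochizuki's normalisation, ANY (Ind3)-data `d`** (c312-3's `ofIdelesM` is the
minimal datum): at `p > 2` outside `dst ⊇ char(S)` with every `K_{v̲}` (`v ∣ p`) unramified, `log μ̄(hull(U_Θ)_{v⃗}) = 0`
in the degrees `1 ≤ j ≤ ℓ⋇`. [cite: Mochizuki2012, IUTchIV Thm 1.10 proof Step (vi) p.29] -/
theorem logμ_hullUTheta_ofPrimesLineM_eq_zero
    (d : ∀ (p : ℕ) (hp : p.Prime), (@realPrimePacketM F _ _ p ⟨hp⟩ (𝔽 p hp)).DHDatum X)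
    (dst : Finset ℕ) (hST : ∀ v ∈ X.S, residueChar F v ∈ dst)
    {p : ℕ} [hp : Fact p.Prime] (hpd : p ∉ dst) (hodd : 2 < p)
    (hunram : ∀ v : placesOver F p, absRamificationIdx p ((𝔽 p hp.out).k v) = 1)
    {j : ℕ} (hj : 1 ≤ j) (hjl : j ≤ X.lstar) (e : Fin (j + 1) → placesOver F p) :
    (ofPrimesLine X (fun q hq => @realPrimePacketM F _ _ q ⟨hq⟩ (𝔽 q hq)) d T T_prime S_sub).M.logμ
      ((ofPrimesLine X (fun q hq => @realPrimePacketM F _ _ q ⟨hq⟩ (𝔽 q hq)) d T T_prime S_sub).M.hullUTheta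
        (ofPrimesLine X (fun q hq => @realPrimePacketM F _ _ q ⟨hq⟩ (𝔽 q hq)) d T T_prime S_sub).ind3 p j e) = 0 :=
  logμ_hullUTheta_ofPrimesLine_eq_zero X (fun q hq => @realPrimePacketM F _ _ q ⟨hq⟩ (𝔽 q hq)) d T T_prime S_sub
    dst hST hp.out hpd hj hjl
    (fun e' => realPrimePacketM_shell_eq_O p (𝔽 p hp.out) hodd hj e' (fun a => hunram (e' a)))
    (fun e' => realPrimePacketM_hullLoc_O p (𝔽 p hp.out) e')
    (fun e' t ht => realPrimePacketM_peel_O_of_ordv_eq_zero p (𝔽 p hp.out) e' t ht) e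

/-- **`hoff` over the real model in Mochizuki's normalisation, ANY data** (the shape consumed by
`localProofDataAvgOfDH`). [cite: Mochizuki2012, IUTchIV Thm 1.10 proof Step (vi) p.29] [claim: Mochizuki2012, status: disputed] -/
theorem hoff_ofPrimesLineM
    (d : ∀ (p : ℕ) (hp : p.Prime), (@realPrimePacketM F _ _ p ⟨hp⟩ (𝔽 p hp)).DHDatum X)
    (dst : Finset ℕ) (hST : ∀ v ∈ X.S, residueChar F v ∈ dst)
    (hodd : ∀ p ∈ T, p ∉ dst → 2 < p)
    (hunram : ∀ (p : ℕ) [hp : Fact p.Prime], p ∈ T → p ∉ dst → ∀ v : placesOver F p,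
      absRamificationIdx p ((𝔽 p hp.out).k v) = 1) :
    ∀ p ∈ (ofPrimesLine X (fun q hq => @realPrimePacketM F _ _ q ⟨hq⟩ (𝔽 q hq)) d T T_prime S_sub).T, p ∉ dst →
      ∀ j, 1 ≤ j → j ≤ (ofPrimesLine X (fun q hq => @realPrimePacketM F _ _ q ⟨hq⟩ (𝔽 q hq)) d T T_prime S_sub).X.lstar →
        ∀ e : Fin (j + 1) → placesOver F p,
          (ofPrimesLine X (fun q hq => @realPrimePacketM F _ _ q ⟨hq⟩ (𝔽 q hq)) d T T_prime S_sub).M.logμ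
            ((ofPrimesLine X (fun q hq => @realPrimePacketM F _ _ q ⟨hq⟩ (𝔽 q hq)) d T T_prime S_sub).M.hullUTheta
              (ofPrimesLine X (fun q hq => @realPrimePacketM F _ _ q ⟨hq⟩ (𝔽 q hq)) d T T_prime S_sub).ind3 p j e)
            ≤ 0 := by
  intro p hpT hpd j hj hjl e
  haveI : Fact p.Prime := ⟨T_prime p hpT⟩
  exact (logμ_hullUTheta_ofPrimesLineM_eq_zero X 𝔽 T T_prime S_sub d dst hST hpd (hodd p hpT hpd)
    (hunram p hpT hpd) hj hjl e).le

/-- **Stabilisation, Mochizuki normalisation, ANY data**: off a finite `T₀ ⊇ T` outside which every prime is odd with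
unramified fields, (1.1) with `Σ_p` ⟺ its truncation to `T₀`. HYPOTHESES on both sides. [claim: Mochizuki2012, status: disputed] -/
theorem cor312DHLim_ofPrimesLineM_iff
    (d : ∀ (p : ℕ) (hp : p.Prime), (@realPrimePacketM F _ _ p ⟨hp⟩ (𝔽 p hp)).DHDatum X)
    (T₀ : Finset ℕ) (hT : T ⊆ T₀) (hT₀ : ∀ p ∈ T₀, p.Prime)
    (hodd : ∀ p : ℕ, p.Prime → p ∉ T₀ → 2 < p)
    (hunram : ∀ (p : ℕ) [hp : Fact p.Prime], p ∉ T₀ → ∀ v : placesOver F p,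
      absRamificationIdx p ((𝔽 p hp.out).k v) = 1) :
    (ofPrimesLine X (fun q hq => @realPrimePacketM F _ _ q ⟨hq⟩ (𝔽 q hq)) d T T_prime S_sub).Cor312DHLim ↔
      (ofPrimesLine X (fun q hq => @realPrimePacketM F _ _ q ⟨hq⟩ (𝔽 q hq)) d T T_prime S_sub).Cor312DHOn T₀ :=
  (ofPrimesLine X (fun q hq => @realPrimePacketM F _ _ q ⟨hq⟩ (𝔽 q hq)) d T T_prime S_sub).cor312DHLim_iff_of_degrees
    (fun p hp hpT j hj hjl e => by
      haveI : Fact p.Prime := ⟨hp⟩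
      exact logμ_hullUTheta_ofPrimesLineM_eq_zero X 𝔽 T T_prime S_sub d T₀ (fun v hv => hT (S_sub v hv)) hpT
        (hodd p hp hpT) (hunram p hpT) hj hjl e)
    hT hT₀

end Real

/-! ## 4. `−|log(Θ)|` is monotone in the (Ind3)-region: the sharp datum gives the strongest form of (1.1) -/

section Ind3Mono

variable (D : DHData F) (E : D.M.Ind3Datum D.tΘ) (hE : D.M.RegionAdm (D.M.hullUTheta E))

/-- `ln ν̄_𝕃` over `T` is monotone under componentwise inclusions AT THE PRIMES OF `T` (the other components are never
summed). [cite: DupuyHilado2025, Def. 3.6.3] -/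
theorem lnνL_mono_on (M : PacketModel F) (lstar : ℕ) (T : Finset ℕ) {A B : M.Region}
    (hA : M.RegionAdm A) (hB : M.RegionAdm B) (hAB : ∀ p ∈ T, ∀ (j : ℕ) (e : Fin (j + 1) → placesOver F p),
      A p j e ⊆ B p j e) : M.lnνL lstar T A ≤ M.lnνL lstar T B := by
  unfold PacketModel.lnνL PacketModel.lnνLp PacketModel.lnνTensorPower
  refine Finset.sum_le_sum fun p hp => mul_le_mul_of_nonneg_left
    (Finset.sum_le_sum fun i _ => Finset.sum_le_sum fun e _ =>
      mul_le_mul_of_nonneg_right (M.logμ_mono (hA p _ e) (hB p _ e) (hAB p hp _ e))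
        (Finset.prod_nonneg fun k _ => weight_nonneg F (e k).1)) ?_
  positivity

/-- **`U_Θ` grows with the (Ind3)-region** ((Ind1) transports and (Ind2) maps are maps of sets).
[cite: DupuyHilado2025, §4.7, §4.9, §4.11] -/
theorem UThetaUnion_mono_ind3 {p : ℕ}
    (h : ∀ (j : ℕ) (e : Fin (j + 1) → placesOver F p), D.ind3.bare3 p j e ⊆ E.bare3 p j e)
    (j : ℕ) (e : Fin (j + 1) → placesOver F p) : D.M.UThetaUnion D.ind3 p j e ⊆ D.M.UThetaUnion E p j e := by
  intro x hx
  obtain ⟨lam, hlam⟩ := Set.mem_iUnion.mp hx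
  refine Set.mem_iUnion.mpr ⟨lam, ?_⟩
  change x ∈ lam.1 p j e • (D.M.perm (lam.2 j) e '' D.ind3.bare3 p j (e ∘ lam.2 j)) at hlam
  change x ∈ lam.1 p j e • (D.M.perm (lam.2 j) e '' E.bare3 p j (e ∘ lam.2 j))
  exact Set.smul_set_mono (Set.image_mono (h j (e ∘ lam.2 j))) hlam

/-- **`hull(U_Θ)` grows with the (Ind3)-region** (local hulls are monotone). [cite: DupuyHilado2025, §4.12] -/
theorem hullUTheta_mono_ind3 {p : ℕ}
    (h : ∀ (j : ℕ) (e : Fin (j + 1) → placesOver F p), D.ind3.bare3 p j e ⊆ E.bare3 p j e)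
    (j : ℕ) (e : Fin (j + 1) → placesOver F p) : D.M.hullUTheta D.ind3 p j e ⊆ D.M.hullUTheta E p j e :=
  (D.M.hullLoc p j e).monotone (D.UThetaUnion_mono_ind3 E h j e)

/-- **`−|log(Θ)| = ln ν̄_𝕃(hull(U_Θ))` is MONOTONE in the (Ind3)-region** (same pilot data, packets, primes and ideles;
inclusion required only at the primes of `T`). [cite: DupuyHilado2025, §1 (1.1), §4.10–4.12] -/
theorem negLogThetaDH_mono_ind3
    (h : ∀ p ∈ D.T, ∀ (j : ℕ) (e : Fin (j + 1) → placesOver F p), D.ind3.bare3 p j e ⊆ E.bare3 p j e) :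
    D.negLogThetaDH ≤ ({ D with ind3 := E, hull_adm := hE } : DHData F).negLogThetaDH :=
  lnνL_mono_on D.M.toPacketModel D.X.lstar D.T D.hull_adm hE fun p hp j e => D.hullUTheta_mono_ind3 E (h p hp) j e

/-- **Dupuy–Hilado's (1.1) is inherited by every LARGER (Ind3)-datum**: if `Cor312DH` holds for `D`, it holds for `D`
with its (Ind3)-region replaced by any admissible `E ⊇` it (at the primes of `T`). HYPOTHESES on both sides; nothing
asserted. [claim: Mochizuki2012, status: disputed] -/
theorem cor312DH_mono_ind3
    (h : ∀ p ∈ D.T, ∀ (j : ℕ) (e : Fin (j + 1) → placesOver F p), D.ind3.bare3 p j e ⊆ E.bare3 p j e)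
    (hD : D.Cor312DH) : ({ D with ind3 := E, hull_adm := hE } : DHData F).Cor312DH :=
  le_trans hD (D.negLogThetaDH_mono_ind3 E hE h)

/-- **An estimate `EstimateDH δ` descends to every SMALLER (Ind3)-datum.** [cite: Mochizuki2012, IUTchIV Thm 1.10 proof Step (v) p.28] -/
theorem estimateDH_anti_ind3 {δ : ℝ}
    (h : ∀ p ∈ D.T, ∀ (j : ℕ) (e : Fin (j + 1) → placesOver F p), D.ind3.bare3 p j e ⊆ E.bare3 p j e)
    (hE' : ({ D with ind3 := E, hull_adm := hE } : DHData F).EstimateDH δ) : D.EstimateDH δ :=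
  le_trans (D.negLogThetaDH_mono_ind3 E hE h) hE'

/-- **(1.1) for a SHARP datum implies (1.1) for EVERY admissible (Ind3)-datum on the same ideles**: a sharp region
(`⊆ O_𝕃(−P_Θ)`, at the primes of `T`) lies in every (Ind3)-region (`Ind3Datum.region_subset`). The sharp/minimal
reading (planner ruling R6-b's main line) is thus the STRONGEST of the recorded DH readings of (Ind3). HYPOTHESES on
both sides; nothing asserted. [claim: Mochizuki2012, status: disputed] -/
theorem cor312DH_ind3_of_sharp
    (hsharp : ∀ p ∈ D.T, ∀ (j : ℕ) (e : Fin (j + 1) → placesOver F p),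
      D.ind3.bare3 p j e ⊆ D.M.region D.tΘ p j e)
    (hD : D.Cor312DH) : ({ D with ind3 := E, hull_adm := hE } : DHData F).Cor312DH :=
  D.cor312DH_mono_ind3 E hE (fun p hp j e => (hsharp p hp j e).trans (E.region_subset p j e)) hD

end Ind3Mono

/-- **(1.1) for the idele-built main-line datum `ofIdelesM` implies (1.1) for EVERY admissible (Ind3)-datum over the
same packets and ideles** (its region IS `O_𝕃(−P_Θ)`: c312-d1's `ofIdelesM_bare3_subset_region`). HYPOTHESES on both
sides; nothing asserted. [claim: Mochizuki2012, status: disputed] -/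
theorem cor312DH_ind3_of_ofIdelesM (X : PilotData F) (𝔽 : LocalFieldFamily F)
    (tΘ : ∀ (p : ℕ) (hp : p.Prime), Fin X.lstar → (v : placesOver F p) → (@LocalFields.k F _ _ p ⟨hp⟩ (𝔽 p hp) v)ˣ)
    (tΘ_ord : ∀ p hp (i : Fin X.lstar) (v : placesOver F p),
      @LocalFields.ordv F _ _ p ⟨hp⟩ (𝔽 p hp) v (tΘ p hp i v) = X.thetaPilot i v.1)
    (tq : ∀ (p : ℕ) (hp : p.Prime), Fin X.lstar → (v : placesOver F p) → (@LocalFields.k F _ _ p ⟨hp⟩ (𝔽 p hp) v)ˣ)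
    (tq_ord : ∀ p hp (i : Fin X.lstar) (v : placesOver F p),
      @LocalFields.ordv F _ _ p ⟨hp⟩ (𝔽 p hp) v (tq p hp i v) = X.qPilot v.1)
    (T : Finset ℕ) (T_prime : ∀ p ∈ T, p.Prime) (S_sub : ∀ v ∈ X.S, residueChar F v ∈ T)
    (E : (ofIdelesM X 𝔽 tΘ tΘ_ord tq tq_ord T T_prime S_sub).M.Ind3Datum
      (ofIdelesM X 𝔽 tΘ tΘ_ord tq tq_ord T T_prime S_sub).tΘ)
    (hE : (ofIdelesM X 𝔽 tΘ tΘ_ord tq tq_ord T T_prime S_sub).M.RegionAdm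
      ((ofIdelesM X 𝔽 tΘ tΘ_ord tq tq_ord T T_prime S_sub).M.hullUTheta E))
    (hD : (ofIdelesM X 𝔽 tΘ tΘ_ord tq tq_ord T T_prime S_sub).Cor312DH) :
    ({ ofIdelesM X 𝔽 tΘ tΘ_ord tq tq_ord T T_prime S_sub with ind3 := E, hull_adm := hE } : DHData F).Cor312DH :=
  (ofIdelesM X 𝔽 tΘ tΘ_ord tq tq_ord T T_prime S_sub).cor312DH_ind3_of_sharp E hE
    (fun p hp j e => ofIdelesM_bare3_subset_region X 𝔽 tΘ tΘ_ord tq tq_ord T T_prime S_sub (T_prime p hp) j e) hD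

end DHData

end Summit.ABC.IUTFork

end
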